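import Literature.AlgebraicGeometry.HodgeTheory.ZariskiProjectiveBundleSectionPullback
import Literature.AlgebraicGeometry.HodgeTheory.DeformationToNormalConeConstantLift
import Literature.AlgebraicGeometry.HodgeTheory.DeformationToNormalConeDatum
import Literature.AlgebraicGeometry.HodgeTheory.AlgebraicClassesPullback
import Literature.AlgebraicGeometry.HodgeTheory.PulledBackAlgebraicClasses
import Literature.AlgebraicGeometry.HodgeTheory.AlgebraicClassesExteriorProduct
import Literature.AlgebraicGeometry.HodgeTheory.MotivatedClassesAssembly
import Literature.AlgebraicGeometry.HodgeTheory.SmoothBlowupHodgeConjecture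
import HarnessLib

/-!
# Pull-back of algebraic classes along morphisms of smooth projective complex varieties — PROVED
# (Fulton 1998, Cor. 19.2 (b); Voisin II, Prop. 9.21 (i)): the named fact
# `fulton1998_map_mem_algebraicClasses` discharged inside `Literature/`, with its first consequences

Topic `Literature/AlgebraicGeometry/HodgeTheory`. THEOREMS ONLY (no definition, no named fact).

The named fact `fulton1998_map_mem_algebraicClasses` (`AlgebraicClassesPullback`: for every
`ℂ`-morphism `j : X ⟶ Y` of smooth projective complex varieties and every `p`,
`j^*(Nᵖ H²ᵖ(Y(ℂ); ℂ)) ⊆ Nᵖ H²ᵖ(X(ℂ); ℂ)` on the tree's support carrier `algebraicClasses = Nᵖ H²ᵖ`;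
W. Fulton, *Intersection Theory*, Cor. 19.2 (b) "`cl` is contravariant for morphisms of non-singular
varieties", C. Voisin, *Hodge Theory II*, Prop. 9.21 (i) "`i^* cl(Z) = cl(i^* Z)`") is PROVED here
(`fulton1998_map_mem_algebraicClasses_holds'`) by the deformation to the normal cone in coniveau form:

* reduction to the graph `γ_j : X ↪ X ⊗ Y`, a closed immersion of codimension `dim Y`, and `pr_Y` flat
  (Fulton, proof of Prop. 19.2; `DeformationToNormalCone.map_mem_algebraicClasses_of_constantLift`);
* the constant-lift deformation datum `M = Bl_{X × {t₁}}(Y ⊗ ℙ¹)`, strict transform, exceptional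
  divisor (a Zariski `ℙʳ`-bundle by Hartshorne II 8.24 (b)), closure bookkeeping
  (`DeformationToNormalCone.exists_constantLiftDatum`, Fulton §5.1);
* Deligne's decomposition (Hodge III Cor. 8.2.8) + Hironaka for the lifted class, homotopy invariance
  of the slices (`DeformationToNormalCone.ker_le_comap_of_constantLift`, Fulton §6.2);
* the section pull-back for Zariski `ℙʳ`-bundles by Leray–Hirsch and top-down Gysin extraction
  (`ZariskiProjectiveBundle.map_section_mem_algebraicClasses`, Fulton Thm. 3.3 (b), Voisin I Lemma 7.32).

NAME. The discharge is filed PRIMED, `fulton1998_map_mem_algebraicClasses_holds'`: the Summits tree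
already declares `Summit.HodgeConjecture.HodgeConjecture.Theorems.fulton1998_map_mem_algebraicClasses_holds`
(`Summits/HodgeConjecture/HodgeConjecture/Theorems/BoundaryReadoutPullbackAlgebraic.lean`, the same
proof, which `Literature/` may not import), and twelve Summits files outside that namespace refer to it
unqualified while opening BOTH `Literature.AlgebraicGeometry.HodgeTheory` and
`Summit.HodgeConjecture.HodgeConjecture.Theorems (fulton1998_map_mem_algebraicClasses_holds)`
(`CorCM/Stage4StrictRoadDischargePowers`, `Theorems/Ring2AbelianAll*`); an exact-name twin here would
make that identifier ambiguous there. The exact-name alias is a one-line follow-up once those uses are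
qualified. Likewise `Voisin2003_cupProduct_algebraicClasses_holds'` (three such files); the discharge
`Arapura2001_hodgeClasses_algebraic_smoothBlowup_holds` carries its exact name (no such file).

CONSEQUENCES made unconditional here (each was a theorem of the tree under the hypothesis
`(hF : fulton1998_map_mem_algebraicClasses)`):

* `map_mem_algebraicClasses_of_isSmoothProjective` (binder form), `pulledBackAlgebraicClasses_eq_algebraicClasses`
  (`PBᵖ(X) = algebraicClasses X p`, `PulledBackAlgebraicClasses`);
* `Voisin2003_cupProduct_algebraicClasses_holds'` — **cup products of algebraic classes are algebraic,
  `Nˡ H²ˡ ∪ Nᵏ H²ᵏ ⊆ Nˡ⁺ᵏ H²ˡ⁺²ᵏ`** (Voisin II Prop. 9.20: diagonal pull-back of the exterior product,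
  `cupProduct_mem_algebraicClasses_of_forall_map_diagonal`);
* `Andre1996_motivatedClasses_le_algebraicClasses_of_standardConjectureB_holds` — **André 1996 §2.1: conjecture
  `B` for all smooth projective varieties ⟹ motivated classes are algebraic** (`MotivatedClassesAssembly`);
* `Arapura2001_hodgeClasses_algebraic_smoothBlowup_holds` — **the Hodge conjecture is stable under smooth
  blow-ups** (Murre 1977 Lemma 2 / Arapura 2001 Lemma 16, `SmoothBlowupHodgeConjecture`), and its
  corollaries there: birational invariance of HC among smooth projective `n`-folds, `n ≤ 5`
  (`hodgeBirationalInvariant_le_five'`, Arapura Cor. 17), in every dimension modulo HC for the centres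
  (`hodgeBirationalInvariant_of_lowDim_centres'`), transfer along birational morphisms
  (`HodgeConjectureFor.of_isBirational_le_five'`), smooth roofs from `ℙⁿ`
  (`hodgeConjectureFor_of_roof_projectiveSpace_of_le_five'`, Murre's theorem), blow-up towers and
  their surjective images (`hodgeConjectureFor_of_smoothBlowupTower_le_five'`,
  `hodgeConjectureFor_of_tower_surjective_le_five'`, `hodgeConjectureFor_of_tower_surjective_of_lowDim_centres'`).

Provenance: apex of the Literature re-home of the Summits cone of route `BoundaryReadout`, crux
`PullbackAlgebraic` (stmt-HodgeConjecture-1071); the Summits twins of the three discharges are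
`Theorems/BoundaryReadoutPullbackAlgebraic`, `Theorems/EndoscopicMiddleDegreeCupProductAlgebraic`,
`Theorems/SmoothBlowupHodgeConjectureHolds`. Lane `lit-hodgefound`, seat p20.

## References

* [Fulton1998] W. Fulton, Intersection Theory, 2nd ed. (1998), Thm. 3.3 (b), §5.1, §6.2, §19.2
  Prop. 19.2 and Cor. 19.2 (b).
* [VoisinHodgeII2003] C. Voisin, Hodge Theory and Complex Algebraic Geometry II (2003), §9.2.4
  Prop. 9.20 and Prop. 9.21 (i).
* [VoisinHodgeI2002] C. Voisin, Hodge Theory and Complex Algebraic Geometry I (2002), §7.3.3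
  Thm. 7.31, Lemma 7.32.
* [Hartshorne1977] R. Hartshorne, Algebraic Geometry (1977), II Thm. 8.24 (b).
* [DeligneHodgeIII1974] P. Deligne, Théorie de Hodge III, Cor. 8.2.8.
* [Murre1977] J. P. Murre, On the Hodge conjecture for unirational fourfolds, Indag. Math. 39 (1977).
* [Arapura2001HodgeCyclesModuli] D. Arapura, Motivation for Hodge cycles, Lemma 13, 16, 18, Cor. 17.
-/

noncomputable section

open CategoryTheory AlgebraicGeometry MonoidalCategory CartesianMonoidalCategory
open Literature.AlgebraicGeometry Literature.AlgebraicGeometry.Motives Literature.AlgebraicGeometry.Resolution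

namespace Literature.AlgebraicGeometry.HodgeTheory

/-! ### The discharge -/

/-- **Fulton 1998, Cor. 19.2 (b) / Voisin II, Prop. 9.21 (i), on the coniveau carrier — the tree's named
fact `fulton1998_map_mem_algebraicClasses`, PROVED**: for every `ℂ`-morphism `j : X ⟶ Y` of smooth
projective complex varieties and every `p`, `j^*(Nᵖ H²ᵖ(Y(ℂ); ℂ)) ⊆ Nᵖ H²ᵖ(X(ℂ); ℂ)` (graph reduction,
constant-lift deformation to the normal cone, Deligne decomposition, section pull-back by Leray–Hirsch;
module docstring). Primed name: see the module docstring, §NAME.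
[cite: Fulton1998, §19.2 Cor. 19.2 (b), Prop. 19.2, §5.1, §6.2 and Thm. 3.3 (b)]
[cite: VoisinHodgeII2003, Prop. 9.21 (i)] [cite: Hartshorne1977, II Thm. 8.24 (b)]
[cite: DeligneHodgeIII1974, Cor. 8.2.8] -/
theorem fulton1998_map_mem_algebraicClasses_holds' : fulton1998_map_mem_algebraicClasses :=
  fun _ _ _ _ j hY hX p β hβ ↦
    DeformationToNormalCone.map_mem_algebraicClasses_of_constantLift
      (fun _ _ _ _ i hX' hY' hi hr ↦ DeformationToNormalCone.exists_constantLiftDatum i hX' hY' hi hr)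
      (fun _ _ _ _ q s hX' hE htriv hsq p' _ hy ↦
        ZariskiProjectiveBundle.map_section_mem_algebraicClasses q s hX' hE htriv hsq p' hy)
      j hY hX p β hβ

variable {m n : ℕ} {Y X : SchemeOver ℂ}

/-- **Pull-back preserves algebraic classes**, binder form: for `j : X ⟶ Y` between smooth projective
complex varieties and `β ∈ Nᵖ H²ᵖ(Y(ℂ); ℂ)`, `j^* β ∈ Nᵖ H²ᵖ(X(ℂ); ℂ)`.
[cite: Fulton1998, §19.2 Cor. 19.2 (b)] [cite: VoisinHodgeII2003, Prop. 9.21 (i)] -/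
theorem map_mem_algebraicClasses_of_isSmoothProjective (j : X ⟶ Y) (hY : IsSmoothProjective m Y)
    (hX : IsSmoothProjective n X) {p : ℕ} {β : complexBetti Y (2 * p)} (hβ : β ∈ algebraicClasses Y p) :
    complexBetti.map j (2 * p) β ∈ algebraicClasses X p :=
  fulton1998_map_mem_algebraicClasses_holds' j hY hX p β hβ

/-- Submodule form: `j^*(algebraicClasses Y p) ≤ algebraicClasses X p`.
[cite: Fulton1998, §19.2 Cor. 19.2 (b)] -/
theorem map_algebraicClasses_le_of_isSmoothProjective (j : X ⟶ Y) (hY : IsSmoothProjective m Y)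
    (hX : IsSmoothProjective n X) (p : ℕ) :
    (algebraicClasses Y p).map (complexBetti.map j (2 * p)).hom ≤ algebraicClasses X p :=
  fulton1998_map_mem_algebraicClasses_holds'.map_le j hY hX p

/-- **`PBᵖ(X) = algebraicClasses X p` for every smooth projective `X`** (the pulled-back algebraic
classes of `PulledBackAlgebraicClasses` — the `ℂ`-span of all `g^* a`, `g : X ⟶ Y'`, `Y'` smooth
projective, `a` algebraic — are exactly the algebraic classes), now unconditional.
[cite: Fulton1998, §19.2 Cor. 19.2 (b)] [cite: VoisinHodgeII2003, Prop. 9.21 (i)] -/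
theorem pulledBackAlgebraicClasses_eq_algebraicClasses (hX : IsSmoothProjective n X) (p : ℕ) :
    pulledBackAlgebraicClasses X p = algebraicClasses X p :=
  fulton1998_map_mem_algebraicClasses_holds'.pulledBackAlgebraicClasses_eq hX p

/-! ### Cup products of algebraic classes (Voisin II Prop. 9.20) -/

/-- **Cup products of algebraic classes are algebraic — the tree's named fact
`Voisin2003_cupProduct_algebraicClasses`, PROVED**: on a smooth projective complex `V`, `x ∈ Nᵃ H²ᵃ`,
`y ∈ Nᵇ H²ᵇ ⟹ x ∪ y ∈ Nᵃ⁺ᵇ H²ᵃ⁺²ᵇ` (`x ∪ y = Δ^*(pr₁^* x ∪ pr₂^* y)`; exterior products of algebraic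
classes are algebraic unconditionally, `cupProduct_mem_algebraicClasses_of_forall_map_diagonal`, and
the diagonal `Δ : V ⟶ V ⊗ V` pulls algebraic classes back to algebraic classes by
`fulton1998_map_mem_algebraicClasses_holds'`). Primed name: module docstring, §NAME.
[cite: VoisinHodgeII2003, §9.2.4 Prop. 9.20 and Prop. 9.21 (i)] [cite: Fulton1998, §19.2 Cor. 19.2 (b)] -/
theorem Voisin2003_cupProduct_algebraicClasses_holds' : Voisin2003_cupProduct_algebraicClasses :=
  fun _ _ hV a b _ _ hx hy ↦
    cupProduct_mem_algebraicClasses_of_forall_map_diagonal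
      (fun _ _ hW p _ hc ↦ fulton1998_map_mem_algebraicClasses_holds' (lift (𝟙 _) (𝟙 _))
        (IsSmoothProjective.tensor_holds hW hW) hW p _ hc)
      hV a b hx hy

/-! ### The Hodge conjecture under smooth blow-ups (Murre 1977 / Arapura 2001) -/

/-- **Murre 1977 Lemma 2 / Arapura 2001 Lemma 16 — the tree's named fact
`Arapura2001_hodgeClasses_algebraic_smoothBlowup`, PROVED**: for a smooth blow-up
`IsSmoothBlowupAlong n k X Z X' i b` of smooth projective complex varieties, `HC(X) ∧ HC(Z) ⇒ HC(X')`
(the reduction `Arapura2001_hodgeClasses_algebraic_smoothBlowup_of_pullbackAlgebraic` of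
`SmoothBlowupHodgeConjecture` — blow-up formula, Leray–Hirsch on the exceptional divisor, Hodge-class
lift — fed with `fulton1998_map_mem_algebraicClasses_holds'`).
[cite: Murre1977, Lemma 2 (p. 231)] [cite: Arapura2001HodgeCyclesModuli, Lemma 16]
[cite: VoisinHodgeI2002, §7.3.3 Thm. 7.31] -/
theorem Arapura2001_hodgeClasses_algebraic_smoothBlowup_holds :
    Arapura2001_hodgeClasses_algebraic_smoothBlowup :=
  Arapura2001_hodgeClasses_algebraic_smoothBlowup_of_pullbackAlgebraic
    fulton1998_map_mem_algebraicClasses_holds'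

/-- **Arapura 2001 Cor. 17: the Hodge conjecture is a birational invariant of smooth projective complex
`n`-folds, `n ≤ 5`** — unconditionally. [cite: Arapura2001HodgeCyclesModuli, Cor. 17] -/
theorem hodgeBirationalInvariant_le_five' (hn : n ≤ 5) : HodgeBirationalInvariant n :=
  hodgeBirationalInvariant_le_five fulton1998_map_mem_algebraicClasses_holds' hn

/-- **Birational invariance of the Hodge conjecture in any dimension `n`, granted HC for all smooth
projective varieties of dimension `≤ n - 2`.** [cite: Arapura2001HodgeCyclesModuli, Lemma 16 and proof of Cor. 17] -/
theorem hodgeBirationalInvariant_of_lowDim_centres'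
    (hlow : ∀ ⦃k : ℕ⦄ ⦃Z : SchemeOver ℂ⦄, k + 2 ≤ n → IsSmoothProjective k Z → HodgeConjectureFor k Z) :
    HodgeBirationalInvariant n :=
  hodgeBirationalInvariant_of_lowDim_centres fulton1998_map_mem_algebraicClasses_holds' hlow

/-- **HC transfers along a birational morphism of smooth projective `n`-folds, `n ≤ 5`** —
unconditionally. [cite: Arapura2001HodgeCyclesModuli, Cor. 17] -/
theorem HodgeConjectureFor.of_isBirational_le_five' (hn : n ≤ 5) {X X'' : SchemeOver ℂ}
    (hX : IsSmoothProjective n X) (hX'' : IsSmoothProjective n X'') (p : X'' ⟶ X)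
    (hp : IsBirational p.left) (h : HodgeConjectureFor n X) : HodgeConjectureFor n X'' :=
  HodgeConjectureFor.of_isBirational_le_five fulton1998_map_mem_algebraicClasses_holds' hn hX hX'' p hp h

/-- **Murre 1977 / Arapura 2001 Lemma 18: a smooth projective variety of dimension `≤ 5` rationally
dominated by `ℙⁿ` through a smooth roof `ℙⁿ ← W → Y` satisfies the Hodge conjecture** — unconditionally.
[cite: Murre1977, Theorem (p. 232)] [cite: Arapura2001HodgeCyclesModuli, Lemma 18 and Cor. 17] -/
theorem hodgeConjectureFor_of_roof_projectiveSpace_of_le_five' (hn : n ≤ 5) {W Y' : SchemeOver ℂ}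
    (hW : IsSmoothProjective n W) (hY : IsSmoothProjective n Y') (p : W ⟶ projectiveSpace n ℂ)
    (hp : IsBirational p.left) (q : W ⟶ Y') [Surjective q.left] : HodgeConjectureFor n Y' :=
  hodgeConjectureFor_of_roof_projectiveSpace_of_le_five fulton1998_map_mem_algebraicClasses_holds'
    hn hW hY p hp q

/-- **HC climbs smooth blow-up towers on `n`-folds, `n ≤ 5`** — unconditionally.
[cite: Murre1977, proof of the Theorem (p. 232)] [cite: Arapura2001HodgeCyclesModuli, Cor. 17] -/
theorem hodgeConjectureFor_of_smoothBlowupTower_le_five' (hn : n ≤ 5) {X X'' : SchemeOver ℂ}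
    (ht : Relation.ReflTransGen (SmoothBlowupStep n) X X'') (h : HodgeConjectureFor n X) :
    HodgeConjectureFor n X'' :=
  hodgeConjectureFor_of_smoothBlowupTower_le_five fulton1998_map_mem_algebraicClasses_holds' hn ht h

/-- **Arapura 2001 Lemma 13 + Lemma 16 + Hironaka, `n ≤ 5` — unconditionally: if the smooth projective
`m`-fold `Y` is the surjective image of the top of a smooth blow-up tower over a smooth projective
`n`-fold `X` with `HC(X)`, then `HC(Y)`.** [cite: Arapura2001HodgeCyclesModuli, Lemma 13, Lemma 16 and Cor. 17]
[cite: Murre1977, Theorem (p. 232)] -/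
theorem hodgeConjectureFor_of_tower_surjective_le_five' (hn : n ≤ 5) {m : ℕ} {X X₃ Y' : SchemeOver ℂ}
    (ht : Relation.ReflTransGen (SmoothBlowupStep n) X X₃) (hX₃ : IsSmoothProjective n X₃)
    (hY : IsSmoothProjective m Y') (r : X₃ ⟶ Y') [Surjective r.left] (h : HodgeConjectureFor n X) :
    HodgeConjectureFor m Y' :=
  hodgeConjectureFor_of_tower_surjective_le_five fulton1998_map_mem_algebraicClasses_holds' hn ht hX₃ hY r h

/-- **The same in every dimension `n`, granted HC for the centres (dimension `≤ n - 2`).**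
[cite: Arapura2001HodgeCyclesModuli, Lemma 13 and Lemma 16] -/
theorem hodgeConjectureFor_of_tower_surjective_of_lowDim_centres' {m : ℕ} {X X₃ Y' : SchemeOver ℂ}
    (hlow : ∀ ⦃k : ℕ⦄ ⦃Z : SchemeOver ℂ⦄, k + 2 ≤ n → IsSmoothProjective k Z → HodgeConjectureFor k Z)
    (ht : Relation.ReflTransGen (SmoothBlowupStep n) X X₃) (hX₃ : IsSmoothProjective n X₃)
    (hY : IsSmoothProjective m Y') (r : X₃ ⟶ Y') [Surjective r.left] (h : HodgeConjectureFor n X) :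
    HodgeConjectureFor m Y' :=
  hodgeConjectureFor_of_tower_surjective_of_lowDim_centres fulton1998_map_mem_algebraicClasses_holds'
    hlow ht hX₃ hY r h

/-! ### Motivated classes under conjecture `B` (André 1996, §2.1) -/

/-- **André 1996, §2.1 (remark following Déf. 1): `B` for every smooth projective complex variety ⟹
motivated classes are algebraic — the tree's named fact
`Andre1996_motivatedClasses_le_algebraicClasses_of_standardConjectureB`, PROVED** (the Literature
assembly `Andre1996_motivatedClasses_le_algebraicClasses_of_standardConjectureB_holds_of` — under
`B(Z)`, `*_L β = γ^* β` is algebraic by flat pull-back, product and proper push-forward, then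
`α ∪ *_L β` and its Gysin image are algebraic — fed with the multiplicativity of algebraic classes
`Voisin2003_cupProduct_algebraicClasses_holds'`). Summits twin:
`Summit.HodgeConjecture.HodgeConjecture.Theorems.Andre1996_motivatedClasses_le_algebraicClasses_of_standardConjectureB_holds`
(`Theorems/Ring2LitMotivatedClassesOfStandardB`). [cite: Andre1996Motifs, §2.1 remark following Déf. 1 (p. 14)]
[cite: VoisinHodgeII2003, Prop. 9.20 and Prop. 9.21 (i)] -/
theorem Andre1996_motivatedClasses_le_algebraicClasses_of_standardConjectureB_holds :
    Andre1996_motivatedClasses_le_algebraicClasses_of_standardConjectureB :=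
  Andre1996_motivatedClasses_le_algebraicClasses_of_standardConjectureB_holds_of
    Voisin2003_cupProduct_algebraicClasses_holds'

end Literature.AlgebraicGeometry.HodgeTheory

end
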